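/-
Origin: expansion seat `planner-pub-hodgecm-pv13-g3-0`, handover #5 2026-08-18T07:14:18Z (`HOME/pub-hodgecm-pv13-g3/lean/Pv13g3/SplitRamified.lean`, md5 16709685, 279 lines);
landed by the gen-7 packager in gate run 25 as `HodgeCM/PerL34/SplitRamified.lean` (import ^import Pv13g3\.→import HodgeCM.PerL34. ×1).
-/
/-
Copyright: HodgeCM publication cell (pub-hodgecm), DAG node N31h (seam S3) — split side, RAMIFIED split places.
Prover seat pv13-g3 (DAG-NODE PROVER #13, generation 3), file #5.  Released under the package licence.

# Seam S3, split side at the places `v ∈ S` that are SPLIT: `ram_pos_v` and `hclS_v` for the canonical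
# Haar datum from the D4 dictionary; the END FORM with `ram_pos`/`hclS` left only at the COMPACT places of `S`

Source under adjudication (NOT cited; the dictionary sentence is the one residual hypothesis `coeffS`),
PerL v5 = `inputs/2001/summits__hodge-w-picard-modular-quadrilinear-period-galois-closure__free__y1__paper__paper.tex`,
Lemma 4.2(b), proof, verbatim:
  610–611: "... (resp. split, where it is $L_{0,v}^\times$ acting on $\cS(L_{0,v}^3)$ by
           $(\omega(y)\phi)(x)=|y|^{3/2}\phi(yx)$ up to a unitary character)."
  617–623: "... at split $v$ take $\varphi_v$ the characteristic function of a ball $D=x_0+\varpi^N\mathcal O^3$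
           around a point $x_0\neq 0$, with $N>\mathrm{ord}(x_0)$ ... so large that the open subgroup
           $U_1 := \{y : (y-1)x_0 \in \varpi^N\mathcal O^3\}\subset\mathcal O^\times$ lies in the kernels of
           $\chi'_v$ and of the auxiliary unitary character of the Weil representation; ... hence
           $m=\mathrm{vol}(D)\mathbf 1_{U_1}$ and $I_v(\varphi_v)=\mathrm{vol}(D)\,\mathrm{vol}(U_1)>0$."
  629–630: "... at the finitely many $v \in S$ the integral converges absolutely ..."

WHAT THIS FILE DOES (consumer of pv07-g2's landed `LocalFactors.DilationModel.hasSplitModel_of_coeff`, whose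
three residual hypotheses `hmeas / hpos / hfin` — measurability, positivity and finiteness of the Haar volume of
`U₁` read in `U(W_i)(L_{0,v})` — and whose `hchar` are DISCHARGED here for the CANONICAL HAAR DATUM of pv09-g3
(`PureTensor.localIntegrand B (haarDatum B hBc hBo S₀) ω φ χ i`) along a topological identification
`τ : G i ≃ₜ* Fˣ` (D4, DEFINITIONAL: `U(W_i)(L_{0,v}) = L_{0,v}^×` at a split place):
* `charOfIdent`        — the local character `χ′_i` transported to `Fˣ` (`χ ∘ ι_i ∘ τ⁻¹`); no `hchar` hypothesis;
* `I_pos_of_splitDict` — **`ram_pos` at a split place of `S`**: `0 < I_i` from the dictionary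
                         `localCoeff_i(g) = c · ⟪1_D, ω^{dil}_ν(τ g) 1_D⟫` (`D = closedBall x₀ r`, `0 < r < ‖x₀‖`,
                         `c > 0` = `∏_{w ≠ v} ‖φ_w‖²`), `ν`, `χ′_i` trivial on `U₁` (ll. 619–621);
* `localCoeff_eq_indicator_of_splitDict`, `integrable_localCoeff_of_splitDict` — **`hclS` at a split place of
                         `S`** (l. 629–630 "converges absolutely"): the local coefficient IS `c·vol(D)·1_{τ⁻¹U₁}`,
                         an integrable function for the local Haar measure (`U₁` compact open);
* `haarDatum_ν_univ`   — the trivial discharge `ν_i(univ) = 1 ⇐ B_i = univ` (hypothesis `hν1` of #3/#4);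
* `theta_ne_zero_levels_adic_ram` — **END FORM**: #4's `theta_ne_zero_levels_adic_canonical` with `hν1` GONE and
                         `hclS`, `ram_pos` required ONLY at the non-split (compact) places of `S`; at the split places
                         of `S` they are replaced by the identification `τ_v`, the ball data `(x₀_v, r_v)`, the
                         constant `c_v > 0`, "N large" (`ν_v`, `χ′_v` trivial on `U₁`) and ONE DICT sentence `coeffS`.
Nothing cited, nothing asserted; complete proofs; axioms = the standard trio (see `#print axioms` log in the handover).
-/
import Summits.HodgeConjecture.HodgeCM.PerL34.SplitHaarAdic

noncomputable section

open MeasureTheory MeasureTheory.Measure Set Metric Function Complex ComplexConjugate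
open scoped RestrictedProduct InnerProductSpace NNReal ENNReal

namespace HodgeCM.PerL34.SplitShells

open HodgeCM.PerL34.PureTensor HodgeCM.PerL34.AdelicFactorisation HodgeCM.PerL34.RestrictedMeasure
open HodgeCM.PerL34.NoSmallSubgroups HodgeCM.PerL34.EulerFactorisation
open HodgeCM.PerL34.LocalFactors HodgeCM.PerL34.LocalFactors.DilationModel

/-! ## §1 One split place of `S`: `ram_pos` and `hclS` from the dictionary -/

section ramifiedPlace

variable {ι : Type} {G : ι → Type} [∀ i, CommGroup (G i)] [∀ i, TopologicalSpace (G i)]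
  [∀ i, IsTopologicalGroup (G i)] [∀ i, T2Space (G i)] [∀ i, SecondCountableTopology (G i)]
  [∀ i, LocallyCompactSpace (G i)] [∀ i, MeasurableSpace (G i)] [∀ i, BorelSpace (G i)]
  [Countable ι] [DecidableEq ι]
  (B : ∀ i, Subgroup (G i)) (hBc : ∀ i, IsCompact (B i : Set (G i)))
  (hBo : ∀ i, IsOpen (B i : Set (G i))) (S₀ : Finset ι)
  {Sp : Type} [NormedAddCommGroup Sp] [InnerProductSpace ℂ Sp]
  (ω : (Πʳ j, [G j, B j]) →* (Sp ≃ₗᵢ[ℂ] Sp)) (φ : Sp)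
  (χ : (Πʳ j, [G j, B j]) →* Circle)
  {F : Type} [NormedField F] [IsUltrametricDist F] [ProperSpace F] {n : ℕ}

omit [∀ i, LocallyCompactSpace (G i)] [DecidableEq ι] in
/-- **`ν_i(univ) = 1` at a place where `B_i` is everything** (the compact non-split places): hypothesis `hν1`
of `theta_ne_zero_levels_of_splitModels` / `…_adic_canonical` is a consequence of `hBi`. -/
theorem haarDatum_ν_univ (i : ι) (hBi : (B i : Set (G i)) = univ) :
    (haarDatum B hBc hBo S₀).ν i univ = 1 := by
  rw [← hBi]
  exact haarDatum_ν_self B hBc hBo S₀ i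

omit [∀ i, IsTopologicalGroup (G i)] [∀ i, T2Space (G i)] [∀ i, SecondCountableTopology (G i)]
  [∀ i, LocallyCompactSpace (G i)] [∀ i, MeasurableSpace (G i)] [∀ i, BorelSpace (G i)] [Countable ι] [IsUltrametricDist F] [ProperSpace F] in
/-- The local character `χ′_i = χ′ ∘ ι_i` read on `Fˣ` through the identification `τ : U(W_i)(L_{0,v}) ≃ L_{0,v}^×`. -/
def charOfIdent (i : ι) (τ : G i ≃ₜ* Fˣ) : Fˣ →* Circle :=
  (χ.comp (inclHom B i)).comp τ.symm.toMulEquiv.toMonoidHom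

omit [∀ i, IsTopologicalGroup (G i)] [∀ i, T2Space (G i)] [∀ i, SecondCountableTopology (G i)]
  [∀ i, LocallyCompactSpace (G i)] [∀ i, MeasurableSpace (G i)] [∀ i, BorelSpace (G i)] [Countable ι]
  [IsUltrametricDist F] [ProperSpace F] in
/-- (Ported verbatim from the HodgeCMPerL package; no docstring in the source.) -/
@[simp] theorem charOfIdent_apply (i : ι) (τ : G i ≃ₜ* Fˣ) (y : Fˣ) :
    charOfIdent B χ i τ y = χ (RestrictedProduct.mulSingle B i (τ.symm y)) := rfl

variable [MeasurableSpace (Fin n → F)] [BorelSpace (Fin n → F)] (μV : Measure (Fin n → F))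
  [μV.IsAddHaarMeasure] (ν : Fˣ →* Circle) (x₀ : Fin n → F) (r : ℝ)

/-- the model coefficient at `1_D` is pv07's `ballCoeff` with the weight `ν(y)|y|^{n/2}` (pv07-g2, by `rfl`). -/
theorem inner_ballIndicator_dilationRep (y : Fˣ) :
    ⟪ballIndicator μV x₀ r, dilationRep μV ν y (ballIndicator μV x₀ r)⟫_ℂ
      = ballCoeff (extendUnits (weight (Fin n → F) ν)) μV x₀ r (y : F) := by
  rw [ballIndicator, inner_indicator_dilationRep, ballCoeff, extendUnits_val]
  rfl

omit [∀ i, IsTopologicalGroup (G i)] [∀ i, T2Space (G i)] [∀ i, SecondCountableTopology (G i)]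
  [∀ i, LocallyCompactSpace (G i)] [∀ i, MeasurableSpace (G i)] [∀ i, BorelSpace (G i)] [Countable ι] in
/-- **The local coefficient at a split place of `S` IS `c · vol(D) · 1_{τ⁻¹ U₁}`** (tex l. 622 "`m = vol(D)1_{U₁}`",
times the constant `c = ∏_{w ≠ v}‖φ_w‖²` of the pure tensor). -/
theorem localCoeff_eq_indicator_of_splitDict (i : ι) (τ : G i ≃ₜ* Fˣ) (hr : r < ‖x₀‖) (c : ℂ)
    (hν : ∀ y : Fˣ, (y : F) ∈ U1 x₀ r → ν y = 1)
    (hcoeff : ∀ g : G i, localCoeff B ω φ i g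
      = c * ⟪ballIndicator μV x₀ r, dilationRep μV ν (τ g) (ballIndicator μV x₀ r)⟫_ℂ) :
    localCoeff B ω φ i
      = (τ ⁻¹' ((Units.val : Fˣ → F) ⁻¹' U1 x₀ r)).indicator fun _ => c * (μV.real (closedBall x₀ r) : ℂ) := by
  funext g
  rw [hcoeff g, inner_ballIndicator_dilationRep, ballCoeff_eq_indicator hr (extendUnits_weight_eq_one ν hr hν)]
  by_cases hg : g ∈ τ ⁻¹' ((Units.val : Fˣ → F) ⁻¹' U1 x₀ r)
  · rw [indicator_of_mem hg, indicator_of_mem (show ((τ g : Fˣ) : F) ∈ U1 x₀ r from hg)]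
  · rw [indicator_of_notMem hg, indicator_of_notMem (show ((τ g : Fˣ) : F) ∉ U1 x₀ r from hg), mul_zero]

omit [∀ i, IsTopologicalGroup (G i)] [∀ i, T2Space (G i)] [∀ i, SecondCountableTopology (G i)]
  [∀ i, LocallyCompactSpace (G i)] [∀ i, MeasurableSpace (G i)] [∀ i, BorelSpace (G i)] [Countable ι] [DecidableEq ι]
  [ProperSpace F] [MeasurableSpace (Fin n → F)] [BorelSpace (Fin n → F)] in
/-- `τ⁻¹(U₁)` is open, compact and contains `1`. -/
theorem isOpen_ident_preimage_U1 (i : ι) (τ : G i ≃ₜ* Fˣ) (hr0 : 0 < r) :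
    IsOpen (τ ⁻¹' ((Units.val : Fˣ → F) ⁻¹' U1 x₀ r)) :=
  ((isOpen_U1 hr0).preimage Units.continuous_val).preimage (map_continuous τ)

omit [∀ i, IsTopologicalGroup (G i)] [∀ i, T2Space (G i)] [∀ i, SecondCountableTopology (G i)]
  [∀ i, LocallyCompactSpace (G i)] [∀ i, MeasurableSpace (G i)] [∀ i, BorelSpace (G i)] [Countable ι] [DecidableEq ι]
  [MeasurableSpace (Fin n → F)] [BorelSpace (Fin n → F)] in
/-- (Ported verbatim from the HodgeCMPerL package; no docstring in the source.) -/
theorem isCompact_ident_preimage_U1 (i : ι) (τ : G i ≃ₜ* Fˣ) (hr : r < ‖x₀‖) (hr0 : 0 < r) :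
    IsCompact (τ ⁻¹' ((Units.val : Fˣ → F) ⁻¹' U1 x₀ r)) := by
  have h := (τ.toHomeomorph.isCompact_preimage).2 (isCompact_val_preimage_U1 (n := n) hr hr0)
  exact h

omit [∀ i, IsTopologicalGroup (G i)] [∀ i, T2Space (G i)] [∀ i, SecondCountableTopology (G i)]
  [∀ i, LocallyCompactSpace (G i)] [∀ i, MeasurableSpace (G i)] [∀ i, BorelSpace (G i)] [Countable ι] [DecidableEq ι]
  [IsUltrametricDist F] [ProperSpace F] [MeasurableSpace (Fin n → F)] [BorelSpace (Fin n → F)] in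
/-- (Ported verbatim from the HodgeCMPerL package; no docstring in the source.) -/
theorem one_mem_ident_preimage_U1 (i : ι) (τ : G i ≃ₜ* Fˣ) (hr0 : 0 < r) :
    (1 : G i) ∈ τ ⁻¹' ((Units.val : Fˣ → F) ⁻¹' U1 x₀ r) := by
  change ((τ 1 : Fˣ) : F) ∈ U1 x₀ r
  rw [map_one, Units.val_one]
  exact one_mem_U1 hr0.le

omit [∀ i, LocallyCompactSpace (G i)] in
/-- **`hclS` at a split place of `S`** (tex l. 629–630 "at the finitely many `v ∈ S` the integral converges
absolutely"): the local coefficient is integrable for the local Haar measure of the canonical datum. -/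
theorem integrable_localCoeff_of_splitDict (i : ι) (τ : G i ≃ₜ* Fˣ) (hr : r < ‖x₀‖) (hr0 : 0 < r) (c : ℂ)
    (hν : ∀ y : Fˣ, (y : F) ∈ U1 x₀ r → ν y = 1)
    (hcoeff : ∀ g : G i, localCoeff B ω φ i g
      = c * ⟪ballIndicator μV x₀ r, dilationRep μV ν (τ g) (ballIndicator μV x₀ r)⟫_ℂ) :
    Integrable (localCoeff B ω φ i) ((haarDatum B hBc hBo S₀).ν i) := by
  rw [localCoeff_eq_indicator_of_splitDict B ω φ μV ν x₀ r i τ hr c hν hcoeff,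
    integrable_indicator_iff (isOpen_ident_preimage_U1 x₀ r i τ hr0).measurableSet, haarDatum_ν]
  exact integrableOn_const ((isCompact_ident_preimage_U1 x₀ r i τ hr hr0).measure_lt_top.ne)

/-- **`ram_pos` at a split place of `S`: `0 < I_i`** for the canonical Haar datum, from the D4 dictionary along
`τ` (pv07-g2 `hasSplitModel_of_coeff` + pv07 `loc_I_pos_of_hasSplitModel`, with `hmeas/hpos/hfin/hchar`
discharged: `τ⁻¹U₁` is open ∋ 1 and compact, the local measure is a Haar measure). -/
theorem I_pos_of_splitDict (i : ι) (τ : G i ≃ₜ* Fˣ) (hr : r < ‖x₀‖) (hr0 : 0 < r) (c : ℝ) (hc : 0 < c)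
    (hν : ∀ y : Fˣ, (y : F) ∈ U1 x₀ r → ν y = 1)
    (hχ : ∀ g : G i, ((τ g : Fˣ) : F) ∈ U1 x₀ r → χ (RestrictedProduct.mulSingle B i g) = 1)
    (hcoeff : ∀ g : G i, localCoeff B ω φ i g
      = (c : ℂ) * ⟪ballIndicator μV x₀ r, dilationRep μV ν (τ g) (ballIndicator μV x₀ r)⟫_ℂ) :
    0 < (localIntegrand B (haarDatum B hBc hBo S₀) ω φ χ i).I := by
  refine loc_I_pos_of_hasSplitModel _
    (hasSplitModel_of_coeff μV x₀ r ν (charOfIdent B χ i τ) (localIntegrand B (haarDatum B hBc hBo S₀) ω φ χ i)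
      (fun g : G i => τ g) c hc hr hr0 hν ?_ hcoeff ?_
      (isOpen_ident_preimage_U1 x₀ r i τ hr0).measurableSet ?_ ?_)
  · intro y hy
    rw [charOfIdent_apply]
    exact hχ (τ.symm y) (by rwa [ContinuousMulEquiv.apply_symm_apply])
  · intro g
    change ((χ (RestrictedProduct.mulSingle B i g) : Circle) : ℂ) = ((charOfIdent B χ i τ (τ g) : Circle) : ℂ)
    rw [charOfIdent_apply, ContinuousMulEquiv.symm_apply_apply]
  · change (haarDatum B hBc hBo S₀).ν i (τ ⁻¹' ((Units.val : Fˣ → F) ⁻¹' U1 x₀ r)) ≠ 0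
    rw [haarDatum_ν]
    exact ((isOpen_ident_preimage_U1 x₀ r i τ hr0).measure_pos _ ⟨1, one_mem_ident_preimage_U1 x₀ r i τ hr0⟩).ne'
  · change (haarDatum B hBc hBo S₀).ν i (τ ⁻¹' ((Units.val : Fˣ → F) ⁻¹' U1 x₀ r)) ≠ ⊤
    rw [haarDatum_ν]
    exact (isCompact_ident_preimage_U1 x₀ r i τ hr hr0).measure_lt_top.ne

end ramifiedPlace

/-! ## §2 END FORM over the completions: `ram_pos`/`hclS` only at the compact places of `S`, `hν1` gone -/

attribute [local instance] LocalFactors.DilationModel.Adic.nontriviallyNormedField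
  LocalFactors.DilationModel.Adic.properSpace

section adicRamEnd

variable {ι : Type} {G : ι → Type} [∀ i, CommGroup (G i)] [∀ i, TopologicalSpace (G i)]
  [∀ i, IsTopologicalGroup (G i)] [∀ i, T2Space (G i)] [∀ i, SecondCountableTopology (G i)]
  [∀ i, LocallyCompactSpace (G i)] [∀ i, MeasurableSpace (G i)] [∀ i, BorelSpace (G i)]
  [Countable ι] [DecidableEq ι]
  (B : ∀ i, Subgroup (G i)) (hBc : ∀ i, IsCompact (B i : Set (G i)))
  (hBo : ∀ i, IsOpen (B i : Set (G i))) (S₀ : Finset ι)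
  {Sp : Type} [NormedAddCommGroup Sp] [InnerProductSpace ℂ Sp]
  {E : Type*} [NormedAddCommGroup E] [InnerProductSpace ℂ E]
  (ω : (Πʳ j, [G j, B j]) →* (Sp ≃ₗᵢ[ℂ] Sp)) (φ : Sp) (hφ : ‖φ‖ = 1)
  (hloc : ∀ (i : ι) (v : Sp), Continuous fun g : G i => ω (RestrictedProduct.mulSingle B i g) v)
  (χ : (Πʳ j, [G j, B j]) →* Circle) {T' : Finset ι}
  (hχT' : RestrictedProduct.boxSubgroup B T' ≤ χ.ker)
  (hlocχ : ∀ i ∈ T', Continuous fun g : G i => χ (RestrictedProduct.mulSingle B i g))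
  (𝓕 : Set (Πʳ j, [G j, B j])) (h𝓕c : IsCompact 𝓕) (h𝓕i : (interior 𝓕).Nonempty)
  (K : (Πʳ j, [G j, B j]) → (Πʳ j, [G j, B j]) → ℂ) (c : ℝ) (c_pos : 0 < c) (θ : E) (Θ : Set E)
  (hθ : θ ∈ Θ)
  (hN31e : RallisIP.N31e_statement (haarDatum B hBc hBo S₀).μ 𝓕 ω φ
    (fun y => ((χ y : Circle) : ℂ)) K (c : ℂ))
  (hnorm : ⟪θ, θ⟫_ℂ = ∫ u in 𝓕, ∫ u' in 𝓕, ((χ u : Circle) : ℂ) * conj ((χ u' : Circle) : ℂ) *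
    K u u' ∂(haarDatum B hBc hBo S₀).μ ∂(haarDatum B hBc hBo S₀).μ)
  {T : Finset ι} (hK : ∀ k ∈ RestrictedProduct.boxSubgroup B T, ω k φ = φ)
  (hM : ∀ S : Finset ι, T ⊆ S → ∀ y : (i : ↥S) → G i,
    inner ℂ φ (ω (extendOne B S y) φ) = ∏ i : ↥S, localCoeff B ω φ i (y i))
  {S : Finset ι} {IsSplit : ι → Prop}
  (hBi : ∀ i, i ∉ S → ¬IsSplit i → (B i : Set (G i)) = Set.univ)
  (hTS : T ⊆ S) (hT'S : T' ⊆ S)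
  /- at the NON-SPLIT places of `S` (archimedean, finite non-split: compact `G_i`) integrability and positivity
     stay inputs (pv09-g3 `integrable_localCoeff_haarDatum_of_compactSpace`; N27/N31a isotypy, pv07 `PiecesRamPos`) -/
  (hclC : ∀ i ∈ S, ¬IsSplit i → Integrable (localCoeff B ω φ i) ((haarDatum B hBc hBo S₀).ν i))
  (ram_posC : ∀ i ∈ S, ¬IsSplit i → 0 < (localIntegrand B (haarDatum B hBc hBo S₀) ω φ χ i).I)
  /- the totally real field `L₀` and the place map `w` (injective OFF `S`; at the split places of `S` it names
     the completion; its values at the non-split places of `S` are immaterial) -/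
  (L₀ : Type) [Field L₀] [NumberField L₀]
  (w : ι → IsDedekindDomain.HeightOneSpectrum (NumberField.RingOfIntegers L₀))
  (hw : ∀ ⦃i j : ι⦄, i ∉ S → j ∉ S → w i = w j → i = j)

include hφ hloc hχT' hlocχ h𝓕c h𝓕i c_pos hθ hN31e hnorm hK hM hBi hTS hT'S hclC ram_posC hw

/-- **`θ ≠ 0` — END FORM of the split side over the completions `L_{0,v}`, ALL split places from the dilation
model.**  Compared with `theta_ne_zero_levels_adic_canonical` (#4): `hν1` is gone (from `hBi`); `hclS` and
`ram_pos` are required only at the non-split places of `S`; at the split places of `S` they are PROVED from the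
identification `τ_v : U(W_i)(L_{0,v}) ≃ L_{0,v}^×`, the ball `D_v = closedBall x₀_v r_v` (`0 < r_v < ‖x₀_v‖`),
the pure-tensor constant `c_v > 0`, "N large" (`ν_v`, `χ′_v` trivial on `U₁`) and the dictionary sentence
`coeffS` (tex l. 610–611 read on `φ_v = 1_D`, l. 617–618). -/
theorem theta_ne_zero_levels_adic_ram
    [∀ i, MeasurableSpace ((w i).adicCompletion L₀)] [∀ i, BorelSpace ((w i).adicCompletion L₀)]
    (ν : ∀ i, ((w i).adicCompletion L₀)ˣ →* Circle) (ord : ∀ i, G i →* Multiplicative ℤ) (ϖ : ∀ i, G i)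
    (ϖF : ∀ i, ((w i).adicCompletion L₀)ˣ) (hϖF : ∀ i, i ∉ S → IsUniformizer (ϖF i))
    (ord_ϖ : ∀ i, i ∉ S → IsSplit i → ord i (ϖ i) = Multiplicative.ofAdd 1)
    (ker_ord : ∀ i, i ∉ S → IsSplit i → ∀ g : G i, ord i g = 1 ↔ g ∈ B i)
    (fixed : ∀ i, i ∉ S → IsSplit i → ∀ b : G i, b ∈ B i → ω (RestrictedProduct.mulSingle B i b) φ = φ)
    (unram : ∀ i, i ∉ S → IsSplit i → ∀ b : G i, b ∈ B i → χ (RestrictedProduct.mulSingle B i b) = 1)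
    (hν : ∀ i, i ∉ S → IsSplit i → ∀ u : ((w i).adicCompletion L₀)ˣ,
      ‖(u : (w i).adicCompletion L₀)‖ = 1 → ν i u = 1)
    (coeff_eq : ∀ i, i ∉ S → IsSplit i → ∀ n : ℤ, localCoeff B ω φ i (ϖ i ^ n)
      = ⟪ballIndicator (Adic.muV L₀ (w i)) 0 1,
          dilationRep (Adic.muV L₀ (w i)) (ν i) (ϖF i ^ n) (ballIndicator (Adic.muV L₀ (w i)) 0 1)⟫_ℂ)
    /- the split places of `S` -/
    (τ : ∀ i, i ∈ S → IsSplit i → (G i ≃ₜ* ((w i).adicCompletion L₀)ˣ))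
    (x₀ : ∀ i, Fin 3 → (w i).adicCompletion L₀) (r cS : ι → ℝ)
    (hr : ∀ i ∈ S, IsSplit i → r i < ‖x₀ i‖) (hr0 : ∀ i ∈ S, IsSplit i → 0 < r i)
    (hcS : ∀ i ∈ S, IsSplit i → 0 < cS i)
    (hνS : ∀ i ∈ S, IsSplit i → ∀ y : ((w i).adicCompletion L₀)ˣ,
      (y : (w i).adicCompletion L₀) ∈ U1 (x₀ i) (r i) → ν i y = 1)
    (hχS : ∀ i (hi : i ∈ S) (hs : IsSplit i), ∀ g : G i,
      ((τ i hi hs g : ((w i).adicCompletion L₀)ˣ) : (w i).adicCompletion L₀) ∈ U1 (x₀ i) (r i) →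
        χ (RestrictedProduct.mulSingle B i g) = 1)
    (coeffS : ∀ i (hi : i ∈ S) (hs : IsSplit i), ∀ g : G i, localCoeff B ω φ i g
      = (cS i : ℂ) * ⟪ballIndicator (Adic.muV L₀ (w i)) (x₀ i) (r i),
          dilationRep (Adic.muV L₀ (w i)) (ν i) (τ i hi hs g) (ballIndicator (Adic.muV L₀ (w i)) (x₀ i) (r i))⟫_ℂ) :
    θ ≠ 0 := by
  classical
  have hν1 : ∀ i, i ∉ S → ¬IsSplit i → (haarDatum B hBc hBo S₀).ν i Set.univ = 1 :=
    fun i hi hs => haarDatum_ν_univ B hBc hBo S₀ i (hBi i hi hs)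
  have hclS : ∀ i ∈ S, Integrable (localCoeff B ω φ i) ((haarDatum B hBc hBo S₀).ν i) := by
    intro i hi
    by_cases hs : IsSplit i
    · exact integrable_localCoeff_of_splitDict B hBc hBo S₀ ω φ (Adic.muV L₀ (w i)) (ν i) (x₀ i) (r i) i
        (τ i hi hs) (hr i hi hs) (hr0 i hi hs) (cS i) (hνS i hi hs) (coeffS i hi hs)
    · exact hclC i hi hs
  have ram_pos : ∀ i ∈ S, 0 < (localIntegrand B (haarDatum B hBc hBo S₀) ω φ χ i).I := by
    intro i hi
    by_cases hs : IsSplit i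
    · exact I_pos_of_splitDict B hBc hBo S₀ ω φ χ (Adic.muV L₀ (w i)) (ν i) (x₀ i) (r i) i (τ i hi hs)
        (hr i hi hs) (hr0 i hi hs) (cS i) (hcS i hi hs) (hνS i hi hs) (hχS i hi hs) (coeffS i hi hs)
    · exact ram_posC i hi hs
  exact theta_ne_zero_levels_adic_canonical B hBc hBo S₀ ω φ hφ hloc χ hχT' hlocχ 𝓕 h𝓕c h𝓕i K c c_pos θ Θ
    hθ hN31e hnorm hK hM hBi hν1 hTS hT'S hclS ram_pos L₀ w hw ν ord ϖ ϖF hϖF ord_ϖ ker_ord fixed unram hν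
    coeff_eq

end adicRamEnd

end HodgeCM.PerL34.SplitShells

end
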